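import Literature.MathematicalPhysics.QuantumFieldTheory.Balaban1983to89.B7Prop3GeneralLinear
import Literature.MathematicalPhysics.QuantumFieldTheory.Balaban1983to89.B8Ineq132

/-!
# `Balaban1983to89.B7Eq125RightInverse` — T. Bałaban, *Averaging operations for lattice gauge theories*, Commun. Math. Phys. **98**
# (1985) 17–51 [Balaban1985Averaging] (125) p. 36: THE MAIN TERM `Q₀(V₀) = Q_{V₀}` OF THE LINEARISED COVARIANT AVERAGING HAS AN
# EXACT RIGHT INVERSE ON THE BLOCK LATTICE — for EVERY background, with no smallness condition

statement-level skeleton of published theorems with citation tags; proofs where landed; nothing here is a claim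
about the Yang–Mills mass gap

PDF held: `paper:balaban1985-cmp98-averaging` (journal page = PDF page + 16), p. 36; the verbatim text of (124)–(126) is quoted in
`B7Prop3GeneralLinear` (NE7c crew) and re-read by this seat (2026-08-21) in the held text.

THE PRINT (verbatim, p. 36).  *«We will denote the main term by Q_{V₀}, or Q₀: (Q₀A)_c = (Q_{V₀}A)_c = Σ_{x∈B(c₋)} L^{−(d+1)}(R_{0,c₋}A)([x, x′]),
(125) and it has an estimate |(Q₀A)_c| ≤ |A| < α₁»*; [Balaban1985BackgroundPropagators] (3.126) p. 420: *«HB = GQ*(QGQ*)⁻¹B»* (the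
operators `G₁`, `H₁` of p. 421, used by [Balaban1985Variational] (45) p. 285 and p. 298), (3.25) p. 394: *«Rf = (I − G′Q′*(Q′G′²Q′*)⁻¹Q′G′)f»*
— the operators `QG₁Q*`, `Q′G′²Q′*` are inverted, which requires `Q*` injective, i.e. `Q` ONTO.  Print does not display the right inverse; this file supplies one for the
main term (125) (the full linear part `Q(V₀) = Q₀ + O(L²α₀)` of (124)/(126) is then onto by perturbation — the sequel `B9Eq315QTorusOnto`).

THE CONSTRUCTION.  Fix the block lattice `Lℤ^d` (corners `L·y`, `y ∈ ℤ^d`).  For the coarse bond `c = ⟨L·y, L·y + Le_κ⟩` the sum (125)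
runs over the `L^d` straight segments `[x, x + Le_κ]`, `x ∈ B(L·y)`; the fine bond `⟨z, z + e_κ⟩` with `z = L·y + (L−1)e_κ` (the LAST
`κ`-bond of the block on the axis through its corner — the «spine bond») lies on exactly `L` of them, namely those from `x = z − je_κ`,
`j = 0, …, L−1`, ALL inside `B(L·y)`, and along each of them it is reached from `c₋ = L·y` by the SAME path: the tree contour `Γ_{c₋,x}`
(b07's `treeWord`, here the straight piece `[L·y, x]` since `x` lies on the axis) followed by `[x, z]`, i.e. the straight segment
`[L·y, z]` of `L − 1` bonds.  Hence `A ↦ (Q₀A)_c` restricted to configurations supported on the spine bonds is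
`A(z, κ) ↦ L · L^{−(d+1)} · R(V₀([L·y, z])) A(z, κ)`, and **`(S w)(z, κ) := L^d · R(V₀([L·y, z]))⁻¹ w(y, κ)`** on the spine bonds, `0`
elsewhere, satisfies **`Q₀(V₀)(S w)(L·y, κ) = w(y, κ)`** exactly — every background `V₀`, every `L ≥ 1`, every `d`.

WHAT IS DEFINED AND PROVED (sorry-free; no `Prop` placeholder; no inequality of the paper asserted).
* §1 block coordinates on `ℤ^d`: `corner L y = L·y`, `blk L z = ⌊z/L⌋`, `blk_corner_add`; `spineSite L κ y = L·y + (L−1)e_κ`.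
* §2 `treeWord_zsmul_e` (the tree contour to a point on a coordinate axis is the straight segment), `hol_seg_add`,
  **`tsum_seg`** (`(R_{0,x}A)([x, x + ne_κ]) = Σ_{j<n} R(V₀([x, x + je_κ])) A(x + je_κ, κ)` — (58)/(125) along a straight segment).
* §3 **`secCfg L V₀ w`** — the section `S w`; `secCfgLin` (it is `ℂ`-linear in `w`); `secCfg_eval` (its values along the segments of (125));
  **`norm_secCfg_le`** (`‖(S w)(z, κ)‖ ≤ L^d · sup‖w‖` for `V₀` in `U1`).
* §4 **`Q0cov_secCfg`**: `Q0cov L V₀ (secCfg L V₀ w) (corner L y) κ = w y κ` — THE EXACT RIGHT INVERSE; flat corollary `Q0form_secCfg_one`.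
MODEL / DECLARED READINGS.  (M1) b07 conventions (`B7Prop1Explicit`: `ℤ^d` sites, units of a normed `ℂ`-algebra, tree contours in the
order `d, d−1, …, 1`, `R(X)Y = XYX⁻¹` = `conjR`); `Q0cov` = (125) as typed by the NE7c crew (`B7Prop3GeneralLinear`).  (M2) the block
lattice is `Lℤ^d` with corners `L·y` (print's `B(c₋)`); the right inverse is relative to it.  (M3) no smallness, no regularity of `V₀` is
used for the identity; `U1` only for the norm bound.
HONEST SCOPE.  Finite combinatorics of (125); not a bound of the paper; NOT summit progress (cell pub-balaban: NE9 NOT PRINTED / NOT PROVED;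
spine PROVED 0/9).  Filed by the pub-balaban NE9 BINDER-row owner lineage `b2b-balaban-t4-ne9-p1` (gen 78); NEW file importing
`B7Prop3GeneralLinear` and `B8Ineq132` (for `conjR_sum`); nothing modified.  Net new unproved facts: 0.
-/

noncomputable section

open scoped BigOperators
open Finset

namespace Literature.MathematicalPhysics.QuantumFieldTheory.Balaban1983to89.B7Eq125RightInverse

open B7Prop1Explicit B7Prop3Flat B7Prop3GeneralRotated B7Prop3GeneralLinear
open B7Eq78Linearization (conjR conjR_apply conjR_add conjR_smul conjR_smul_real)
open B8Ineq132 (conjR_sum)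

-- `Site` alone would resolve to the torus sites of `Setup.lean`; re-export the `ℤ^d` sites of `B7Prop1Explicit`.
export B7Prop1Explicit (Site)

variable {d : ℕ}

/-! ## §1 Block coordinates on `ℤ^d` -/

section Blocks

variable (L : ℕ)

/-- The corner `L·y ∈ ℤ^d` of the block with index `y` (print's `c₋` for the coarse bonds at `y`). [cite: Balaban1985Averaging, (2) p.17] -/
def corner (y : Site d) : Site d := fun i => (L : ℤ) * y i

/-- The block index `⌊z/L⌋` (componentwise) of a site of `ℤ^d`. [cite: Balaban1985Averaging, (2) p.17] -/
def blk (z : Site d) : Site d := fun i => z i / (L : ℤ)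

/-- The «spine site» of the block `y` in direction `κ`: `L·y + (L−1)e_κ`, the starting point of the last `κ`-bond of the block on the
axis through its corner. [cite: Balaban1985Averaging, (125) p.36] -/
def spineSite (κ : Fin d) (y : Site d) : Site d := corner L y + (((L : ℤ) - 1) • e κ)

/-- components of the corner `L·y` (block bookkeeping of (2)). [cite: Balaban1985Averaging, (2) p.17] -/
@[simp] theorem corner_apply (y : Site d) (i : Fin d) : corner L y i = (L : ℤ) * y i := rfl

/-- components of the block index (block bookkeeping of (2)). [cite: Balaban1985Averaging, (2) p.17] -/
@[simp] theorem blk_apply (z : Site d) (i : Fin d) : blk L z i = z i / (L : ℤ) := rfl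

/-- `corner` is additive (block bookkeeping of (2)). [cite: Balaban1985Averaging, (2) p.17] -/
theorem corner_add (y t : Site d) : corner L (y + t) = corner L y + corner L t := by
  funext i; simp [mul_add]

variable {L}

/-- A site of the block `B(L·y)` has block index `y`: `⌊(L·y + s)/L⌋ = y` for `0 ≤ s_i < L` (block bookkeeping of (2) «B(y) = {x : y_μ ≤ x_μ < y_μ + L}»). [cite: Balaban1985Averaging, (2) p.17] -/
theorem blk_corner_add (hL : 0 < L) (y s : Site d) (hs : ∀ i, 0 ≤ s i ∧ s i < L) : blk L (corner L y + s) = y := by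
  funext i
  have hL' : (L : ℤ) ≠ 0 := by exact_mod_cast hL.ne'
  simp only [blk_apply, Pi.add_apply, corner_apply]
  rw [show (L : ℤ) * y i + s i = s i + y i * (L : ℤ) by ring, Int.add_mul_ediv_right _ _ hL',
    Int.ediv_eq_zero_of_lt (hs i).1 (hs i).2, zero_add]

end Blocks

/-! ## §2 Straight segments: the tree contour to an axis point, and `(R_{0,x}A)` along `[x, x + ne_κ]` -/

section Segments

/-- A `flatMap` over a duplicate-free list of a function vanishing off one member is that member's value. [folklore] -/
private theorem flatMap_ite_single {ι β : Type*} [DecidableEq ι] (κ : ι) (w : List β) :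
    ∀ (l : List ι), l.Nodup → κ ∈ l → l.flatMap (fun i => if i = κ then w else []) = w
  | [], _, h => by simp at h
  | a :: l, hnd, hmem => by
    rw [List.flatMap_cons]
    rcases List.mem_cons.1 hmem with rfl | h
    · rw [if_pos rfl, (List.flatMap_eq_nil_iff).2 fun i hi => ?_, List.append_nil]
      have hik : i ≠ κ := fun hik => (List.nodup_cons.1 hnd).1 (by rw [← hik]; exact hi)
      exact if_neg hik
    · have hak : a ≠ κ := fun hak => (List.nodup_cons.1 hnd).1 (by rw [hak]; exact h)
      rw [if_neg hak, List.nil_append]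
      exact flatMap_ite_single κ w l (List.nodup_cons.1 hnd).2 h

/-- **The tree contour `Γ_{y, y + ne_κ}` to a point on the `κ`-axis through `y` is the straight segment** of `n` bonds (all other
coordinate pieces of b07's broken line are empty). [cite: Balaban1985Averaging, p.24] -/
theorem treeWord_zsmul_e (κ : Fin d) (n : ℤ) : treeWord (n • e κ : Site d) = seg κ n := by
  unfold treeWord
  have hf : (fun i : Fin d => seg i ((n • e κ : Site d) i)) = fun i => if i = κ then seg κ n else [] := by
    funext i
    simp only [Pi.smul_apply, e_apply, smul_eq_mul, mul_ite, mul_one, mul_zero]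
    split_ifs with h
    · subst h; rfl
    · exact seg_zero i
  rw [hf]
  exact flatMap_ite_single κ _ _ (List.nodup_reverse.2 (List.nodup_finRange d)) (List.mem_reverse.2 (List.mem_finRange κ))

variable {G : Type*} [Group G]

/-- `V([x, x + (a+b)e_κ]) = V([x, x + ae_κ]) · V([x + ae_κ, x + (a+b)e_κ])`. [cite: Balaban1985Averaging, (9) p.18] -/
theorem hol_seg_add (V : Site d → Fin d → G) (x : Site d) (κ : Fin d) (a b : ℕ) :
    hol V x (seg κ ((a + b : ℕ) : ℤ)) = hol V x (seg κ (a : ℤ)) * hol V (x + (a : ℤ) • e κ) (seg κ (b : ℤ)) := by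
  rw [seg_natCast, seg_natCast, seg_natCast, List.replicate_add, hol_append, disp_replicate, Letter.vec_true]

variable {𝔸 : Type*} [NormedRing 𝔸]

/-- `R(X)0 = 0` (the rotations (56)–(57) are linear). [folklore] -/
private theorem conjR_zero (X : 𝔸ˣ) : conjR X (0 : 𝔸) = 0 := by
  rw [conjR_apply, mul_zero, zero_mul]

/-- `R(X)R(X⁻¹) = R(XX⁻¹) = id` ((57) «R(X)R(Y) = R(XY)»). [cite: Balaban1985Averaging, (57) p.27] -/
theorem conjR_conjR_inv (X : 𝔸ˣ) (Y : 𝔸) : conjR X (conjR X⁻¹ Y) = Y := by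
  rw [← conjR_mul_left, mul_inv_cancel, conjR_apply, Units.val_one, inv_one, Units.val_one, one_mul, mul_one]

/-- **`(R_{0,x}A)([x, x + ne_κ]) = Σ_{j<n} R(V₀([x, x + je_κ])) A(x + je_κ, κ)`** — the rotated functional of p. 28 («the product over
b replaced by the sum», (58)) along a straight segment: each bond variable rotated by the background transport from `x` to its starting
point. [cite: Balaban1985Averaging, (58) p.27, (125) p.36] -/
theorem tsum_seg (V₀ : Site d → Fin d → 𝔸ˣ) (A : Site d → Fin d → 𝔸) (x : Site d) (κ : Fin d) :
    ∀ n : ℕ, tsum V₀ A x (seg κ (n : ℤ)) = ∑ j ∈ range n, conjR (hol V₀ x (seg κ (j : ℤ))) (A (x + (j : ℤ) • e κ) κ)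
  | 0 => by simp
  | n + 1 => by
    rw [sum_range_succ, ← tsum_seg V₀ A x κ n, Nat.cast_succ, show (n : ℤ) + 1 = ((n + 1 : ℕ) : ℤ) by push_cast; rfl,
      seg_natCast, List.replicate_succ', ← seg_natCast, tsum_append_true, disp_seg]

end Segments

/-! ## §3 The section `S w` supported on the spine bonds -/

section Section

variable {𝔸 : Type*} [NormedRing 𝔸] [NormedAlgebra ℂ 𝔸]
variable (L : ℕ)

/-- **THE SECTION `S w`**: on the spine bond `⟨L·y + (L−1)e_κ, L·y + Le_κ⟩` of the block `y` the value
`L^d · R(V₀([L·y, L·y + (L−1)e_κ]))⁻¹ w(y, κ)`, zero on every other bond.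
[cite: Balaban1985Averaging, (125) p.36] -/
def secCfg (V₀ : Site d → Fin d → 𝔸ˣ) (w : Site d → Fin d → 𝔸) (z : Site d) (κ : Fin d) : 𝔸 :=
  if z = spineSite L κ (blk L z) then
    ((L : ℝ) ^ d) • conjR (hol V₀ (corner L (blk L z)) (seg κ (((L - 1 : ℕ) : ℤ))))⁻¹ (w (blk L z) κ)
  else 0

/-- The section is `ℂ`-linear in the coarse configuration `w`. [folklore] -/
def secCfgLin (V₀ : Site d → Fin d → 𝔸ˣ) : (Site d → Fin d → 𝔸) →ₗ[ℂ] (Site d → Fin d → 𝔸) where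
  toFun := secCfg L V₀
  map_add' w w' := by
    funext z κ
    simp only [secCfg, Pi.add_apply]
    split_ifs
    · rw [conjR_add, smul_add]
    · rw [add_zero]
  map_smul' c w := by
    funext z κ
    simp only [secCfg, Pi.smul_apply, RingHom.id_apply]
    split_ifs
    · rw [conjR_smul, smul_comm]
    · rw [smul_zero]

/-- Unfolding of the linear section. [cite: Balaban1985Averaging, (125) p.36] -/
@[simp] theorem secCfgLin_apply (V₀ : Site d → Fin d → 𝔸ˣ) (w : Site d → Fin d → 𝔸) : secCfgLin L V₀ w = secCfg L V₀ w := rfl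

variable {L}

/-- components of the offset `r + c·e_κ`. [folklore] -/
private theorem boxVec_add_smul_apply (r : Fin d → Fin L) (c : ℤ) (κ i : Fin d) :
    (boxVec L r + c • e κ : Site d) i = ((r i : ℕ) : ℤ) + (if i = κ then c else 0) := by
  simp only [Pi.add_apply, boxVec, Pi.smul_apply, e_apply, smul_eq_mul, mul_ite, mul_one, mul_zero]

/-- components of `c·e_κ`. [folklore] -/
private theorem smul_e_apply (c : ℤ) (κ i : Fin d) : (c • e κ : Site d) i = (if i = κ then c else 0) := by
  simp only [Pi.smul_apply, e_apply, smul_eq_mul, mul_ite, mul_one, mul_zero]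

/-- The offset `r + je_κ` (`r ∈ [0, L)^d`, `j < L`) equals `(L−1)e_κ` iff `r` vanishes off the `κ`-axis and `r_κ + j = L − 1`. [folklore] -/
private theorem boxVec_add_eq_iff (κ : Fin d) (r : Fin d → Fin L) (j : ℕ) :
    boxVec L r + ((j : ℤ) • e κ : Site d) = (((L : ℤ) - 1) • e κ) ↔
      (∀ i, i ≠ κ → (r i : ℕ) = 0) ∧ (r κ : ℕ) + j = L - 1 := by
  constructor
  · intro h
    have hc : ∀ i, ((r i : ℕ) : ℤ) + (if i = κ then (j : ℤ) else 0) = (if i = κ then (L : ℤ) - 1 else 0) := fun i => by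
      rw [← boxVec_add_smul_apply, ← smul_e_apply ((L : ℤ) - 1) κ i, h]
    refine ⟨fun i hi => ?_, ?_⟩
    · have := hc i; rw [if_neg hi, if_neg hi] at this; omega
    · have := hc κ; rw [if_pos rfl, if_pos rfl] at this; have := (r κ).isLt; omega
  · rintro ⟨h0, hκ⟩
    funext i
    rw [boxVec_add_smul_apply, smul_e_apply]
    by_cases hi : i = κ
    · rw [if_pos hi, if_pos hi]; subst hi; have := (r i).isLt; omega
    · rw [if_neg hi, if_neg hi, add_zero, h0 i hi]; simp

/-- **The values of `S w` along the segments of (125)**: at the `j`-th site of the straight segment from `x = L·y + r ∈ B(L·y)` in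
direction `κ` (`j < L`) the section vanishes unless `x` lies on the `κ`-axis through the corner and `r_κ + j = L − 1` (the spine bond of
the block `y`), where it is `L^d · R(V₀([L·y, L·y + (L−1)e_κ]))⁻¹ w(y, κ)` — in particular the segments of the block `y` meet no spine bond
of another block in direction `κ`. [cite: Balaban1985Averaging, (125) p.36] -/
theorem secCfg_eval (hL : 1 ≤ L) (V₀ : Site d → Fin d → 𝔸ˣ) (w : Site d → Fin d → 𝔸) (y : Site d) (κ : Fin d)
    (r : Fin d → Fin L) {j : ℕ} (hj : j < L) :
    secCfg L V₀ w (corner L y + boxVec L r + (j : ℤ) • e κ) κ =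
      if (∀ i, i ≠ κ → (r i : ℕ) = 0) ∧ (r κ : ℕ) + j = L - 1 then
        ((L : ℝ) ^ d) • conjR (hol V₀ (corner L y) (seg κ (((L - 1 : ℕ) : ℤ))))⁻¹ (w y κ)
      else 0 := by
  have hL0 : 0 < L := hL
  by_cases hc : (r κ : ℕ) + j < L
  · -- the site lies in the block `y`
    have hs : ∀ i, 0 ≤ (boxVec L r + (j : ℤ) • e κ : Site d) i ∧ (boxVec L r + (j : ℤ) • e κ : Site d) i < L := fun i => by
      rw [boxVec_add_smul_apply]
      by_cases hi : i = κ
      · rw [if_pos hi]; subst hi; constructor <;> omega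
      · rw [if_neg hi, add_zero]; have := (r i).isLt; constructor <;> omega
    have hblk : blk L (corner L y + boxVec L r + (j : ℤ) • e κ) = y := by
      rw [add_assoc]; exact blk_corner_add hL0 y _ hs
    unfold secCfg
    rw [hblk]
    have hiff : (corner L y + boxVec L r + (j : ℤ) • e κ = spineSite L κ y) ↔
        ((∀ i, i ≠ κ → (r i : ℕ) = 0) ∧ (r κ : ℕ) + j = L - 1) := by
      rw [spineSite, add_assoc, add_right_inj, boxVec_add_eq_iff]
    by_cases hP : (∀ i, i ≠ κ → (r i : ℕ) = 0) ∧ (r κ : ℕ) + j = L - 1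
    · rw [if_pos (hiff.2 hP), if_pos hP]
    · rw [if_neg (fun h => hP (hiff.1 h)), if_neg hP]
  · -- the site lies in the next block `y + e_κ`, below its spine bond
    rw [not_lt] at hc
    have hP : ¬ ((∀ i, i ≠ κ → (r i : ℕ) = 0) ∧ (r κ : ℕ) + j = L - 1) := fun h => by omega
    rw [if_neg hP]
    set s' : Site d := boxVec L r + (((j : ℤ) - L) • e κ) with hs'def
    have hz : corner L y + boxVec L r + (j : ℤ) • e κ = corner L (y + e κ) + s' := by
      rw [corner_add, hs'def]; funext i
      simp only [Pi.add_apply, corner_apply, boxVec, Pi.smul_apply, e_apply, smul_eq_mul, mul_ite, mul_one, mul_zero]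
      split_ifs <;> ring
    have hs : ∀ i, 0 ≤ s' i ∧ s' i < L := fun i => by
      rw [hs'def, boxVec_add_smul_apply]
      by_cases hi : i = κ
      · rw [if_pos hi]; subst hi; have := (r i).isLt; constructor <;> omega
      · rw [if_neg hi, add_zero]; have := (r i).isLt; constructor <;> omega
    have hblk : blk L (corner L y + boxVec L r + (j : ℤ) • e κ) = y + e κ := by rw [hz]; exact blk_corner_add hL0 _ _ hs
    unfold secCfg
    rw [hblk, if_neg]
    rw [hz, spineSite, add_right_inj]
    intro h
    have := congr_fun h κ
    rw [hs'def, boxVec_add_smul_apply, smul_e_apply, if_pos rfl, if_pos rfl] at this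
    have hr := (r κ).isLt
    omega

/-- **`‖(S w)(z, κ)‖ ≤ L^d · sup‖w‖`** for a background in `U1` (the rotations do not increase norms). [cite: Balaban1985Averaging, (56)–(57) p.27, (126) p.36] -/
theorem norm_secCfg_le [NormOneClass 𝔸] {V₀ : Site d → Fin d → 𝔸ˣ} (hV₀ : ∀ x κ, V₀ x κ ∈ U1 𝔸)
    {w : Site d → Fin d → 𝔸} {M : ℝ} (hM : 0 ≤ M) (hw : ∀ y κ, ‖w y κ‖ ≤ M) (z : Site d) (κ : Fin d) :
    ‖secCfg L V₀ w z κ‖ ≤ (L : ℝ) ^ d * M := by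
  unfold secCfg
  split_ifs
  · rw [norm_smul, Real.norm_of_nonneg (by positivity)]
    exact mul_le_mul_of_nonneg_left ((norm_conjR_le ((U1 𝔸).inv_mem (hol_mem hV₀ _ _)) _).trans (hw _ _)) (by positivity)
  · rw [norm_zero]; positivity

end Section

/-! ## §4 `Q₀(V₀) ∘ S = id` on the block lattice -/

section RightInverse

variable {𝔸 : Type*} [NormedRing 𝔸] [NormedAlgebra ℂ 𝔸]
variable {L : ℕ}

/-- the unique offset of `B(L·y)` whose `κ`-segment meets the spine bond at its `j`-th site: `(L−1−j)e_κ`. [folklore] -/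
private def rho (hL : 1 ≤ L) (κ : Fin d) (j : ℕ) : Fin d → Fin L := fun i => if i = κ then ⟨L - 1 - j, by omega⟩ else ⟨0, hL⟩

/-- components of `rho`. [folklore] -/
private theorem rho_apply_val (hL : 1 ≤ L) (κ : Fin d) (j : ℕ) (i : Fin d) :
    ((rho hL κ j i : Fin L) : ℕ) = if i = κ then L - 1 - j else 0 := by
  unfold rho; split_ifs <;> rfl

/-- `rho` satisfies the spine condition. [folklore] -/
private theorem rho_spec (hL : 1 ≤ L) (κ : Fin d) {j : ℕ} (hj : j < L) :
    (∀ i, i ≠ κ → (rho hL κ j i : ℕ) = 0) ∧ (rho hL κ j κ : ℕ) + j = L - 1 := by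
  refine ⟨fun i hi => by rw [rho_apply_val, if_neg hi], ?_⟩
  rw [rho_apply_val, if_pos rfl]; omega

/-- … and is the only offset that does. [folklore] -/
private theorem eq_rho_of (hL : 1 ≤ L) (κ : Fin d) {j : ℕ} {r : Fin d → Fin L}
    (h : (∀ i, i ≠ κ → (r i : ℕ) = 0) ∧ (r κ : ℕ) + j = L - 1) : r = rho hL κ j := by
  funext i
  apply Fin.ext
  rw [rho_apply_val]
  by_cases hi : i = κ
  · rw [if_pos hi]; subst hi; omega
  · rw [if_neg hi]; exact h.1 i hi

/-- `rho` as a vector: `(L−1−j)e_κ`. [folklore] -/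
private theorem boxVec_rho (hL : 1 ≤ L) (κ : Fin d) (j : ℕ) :
    boxVec L (rho hL κ j) = (((L - 1 - j : ℕ) : ℤ) • e κ : Site d) := by
  funext i
  rw [smul_e_apply, boxVec, rho_apply_val]
  split_ifs <;> simp

/-- **(125) HAS AN EXACT RIGHT INVERSE ON THE BLOCK LATTICE**: `Q₀(V₀)(S w)(L·y, κ) = w(y, κ)` for every background `V₀`, every
`L ≥ 1`, every coarse configuration `w` — the `L` segments of `B(L·y)` through the spine bond all carry the transporter
`R(V₀([L·y, L·y + (L−1)e_κ]))`, which the section inverts, and `L · L^{−(d+1)} · L^d = 1`. [cite: Balaban1985Averaging, (125) p.36] -/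
theorem Q0cov_secCfg (hL : 1 ≤ L) (V₀ : Site d → Fin d → 𝔸ˣ) (w : Site d → Fin d → 𝔸) (y : Site d) (κ : Fin d) :
    Q0cov L V₀ (secCfg L V₀ w) (corner L y) κ = w y κ := by
  have hL0 : (0 : ℝ) < L := by exact_mod_cast hL
  set X : 𝔸 := ((L : ℝ) ^ d) • conjR (hol V₀ (corner L y) (seg κ (((L - 1 : ℕ) : ℤ))))⁻¹ (w y κ) with hX
  unfold Q0cov
  -- expand the segment sums and evaluate the section along them
  have hinner : ∀ r : Fin d → Fin L,
      tsum V₀ (secCfg L V₀ w) (corner L y + boxVec L r) (seg κ (L : ℤ)) =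
        ∑ j ∈ range L, conjR (hol V₀ (corner L y + boxVec L r) (seg κ (j : ℤ)))
          (if (∀ i, i ≠ κ → (r i : ℕ) = 0) ∧ (r κ : ℕ) + j = L - 1 then X else 0) := fun r => by
    rw [tsum_seg]
    exact sum_congr rfl fun j hj => by rw [secCfg_eval hL V₀ w y κ r (mem_range.1 hj)]
  simp_rw [hinner, conjR_sum, smul_sum]
  rw [sum_comm]
  -- for each `j` exactly one offset contributes
  have hsingle : ∀ j ∈ range L,
      ∑ r : Fin d → Fin L, (((L : ℝ) ^ (d + 1))⁻¹) • conjR (hol V₀ (corner L y) (treeWord (boxVec L r)))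
          (conjR (hol V₀ (corner L y + boxVec L r) (seg κ (j : ℤ)))
            (if (∀ i, i ≠ κ → (r i : ℕ) = 0) ∧ (r κ : ℕ) + j = L - 1 then X else 0)) =
        (((L : ℝ) ^ (d + 1))⁻¹ * (L : ℝ) ^ d) • w y κ := fun j hj => by
    have hjL := mem_range.1 hj
    rw [sum_eq_single (rho hL κ j)]
    · rw [if_pos (rho_spec hL κ hjL), ← conjR_mul_left, boxVec_rho, treeWord_zsmul_e, ← hol_seg_add,
        show L - 1 - j + j = L - 1 by omega, hX, conjR_smul_real, conjR_conjR_inv, smul_smul]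
    · intro r _ hr
      rw [if_neg (fun h => hr (eq_rho_of hL κ h)), conjR_zero, conjR_zero, smul_zero]
    · intro h; exact absurd (mem_univ _) h
  rw [sum_congr rfl hsingle, sum_const, card_range, ← Nat.cast_smul_eq_nsmul ℝ, smul_smul]
  rw [show (L : ℝ) * (((L : ℝ) ^ (d + 1))⁻¹ * (L : ℝ) ^ d) = 1 by field_simp; ring, one_smul]

/-- Flat corollary: the un-rotated block-line average `Q₀` of (125) at `V₀ = 1` (`B7Prop3Flat.Q0form`) has the right inverse `S` with
`(S w)(L·y + (L−1)e_κ, κ) = L^d · w(y, κ)`. [cite: Balaban1985Averaging, (125) p.36] -/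
theorem Q0form_secCfg_one (hL : 1 ≤ L) (w : Site d → Fin d → 𝔸) (y : Site d) (κ : Fin d) :
    Q0form L (secCfg L (1 : Site d → Fin d → 𝔸ˣ) w) (corner L y) κ = w y κ := by
  rw [← Q0cov_one_left, Q0cov_secCfg hL]

end RightInverse

end Literature.MathematicalPhysics.QuantumFieldTheory.Balaban1983to89.B7Eq125RightInverse

end
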